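/-
Copyright (c) 2026 the pub-hodgecm-mathlib formalisation cell (harness21).  Prover seat hodgecm-mathlib-LH4-p05 (g8), Track A «(D-RAM) FOUR-FRAME» squad, helper lane on
h413 = stmt-HodgeConjecture-24833 (count-neutral).  Heir dealer∕pen LH4-plan (g13) WORD #58 RULING B (ii) «(β) PRODUCER, statement-first»; this seat's 11:40:42Z finding
(F1) and 11:43:12Z plan ((β) step (2)): the κ-FORM of the ED. 6 letter (β) `CleanSgnFrameConstLawAt`.  2026-09-04.
-/
import Summits.HodgeConjecture.HodgeConjecture.Theorems.F0P3cDyRamStageOneBDerivedDefs      -- ★ p859675 DEFS LEAF №6 (this seat): (β) `CleanSgnFrameConstLawAt`; brings ★ №5 `cleanMinusFixCount`, ★ `transvPlusFixCount`, ★ #0a `kappaChar`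
import HarnessLib

/-!
# Crux `H413`, line LH4 «(D-RAM) FOUR-FRAME» — THE κ-FORM OF (β): frame-constancy of the clean sign census `T+ − T−′` IS the vanishing of its three κ-censuses,
# and (β) is antitone in the near-1 threshold

Cell `hodgecm-mathlib` (D-0151), FLOOR 0, crux item H413 = `stmt-HodgeConjecture-24833`, route `HCCMUnconditional`; squad F0∕P3c∕LH4.  THEOREMS ONLY (no `def`, no instance, no
notation, no `sorry`, default heartbeats); lane `--supports stmt-HodgeConjecture-24833 --as helper`; pays NO row, states NO law; imports ★ №6 only (the (β) chain never imports
the CONSUMER ★ p859751 `…TransvPlusLawOfCleanLevels` — chair LH4-r01 (g8) BOX MP non-circularity test (ii)).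

WHAT.  A function on the four frames `n : Fin 4 → ℤ` is CONSTANT iff its three non-trivial `(ℤ∕2)²`-Fourier coefficients `Σ_b κ_i(b)·n_b` (`i : Fin 3`, ★ #0a H5 `kappaChar`)
vanish (§1, `Fin 4` inversion: `4·n_b = Σ_b' n_b' + Σ_i κ_i(b)·Σ_b' κ_i(b')·n_b'`).  Hence (§2) the ED. 6 letter (β) `CleanSgnFrameConstLawAt N₀ mc σ ϖ d t` (★ №6: at every
element datum above `N₀ d` the clean sign census `b ↦ #T+(Γ_b) − #T−′(Γ_b)` takes one value on the four frames) is EQUIVALENT to the three κ-CENSUS IDENTITIES WITH AMPLITUDE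
ZERO `Σ_b κ_i(b)·(#T+(Γ_b) − #T−′(Γ_b)) = 0` (`i = 0, 1, 2`) under the same binder prefix — the currency of every G-side law of record (★ №1-R2 `KappaSignLawAtS2`, ★ №6
`TransvPlusKappaSignLawAtS2`), so (β) is «the κ-census of the derived clean sign piece `f_sgn′ = f_{T+} − 𝟙{clean shell ∧ ¬LabelPlus}` vanishes identically near 1».
This is the form the Stage-B strata engines pay (this seat 11:40:42Z (F1)–(F4): given (α′) and the two clean-level laws, the `i`-th identity at a slot the T₊ law binds is
`Ω s·(2·A₊ − (A_lo − A_hi)) = 0`, i.e. (β) carries exactly the T₊ κ-census content).  §3: (β) is ANTITONE in the threshold schedule (`N₀ ≤ N₀′` pointwise ⇒ law at `N₀` ⇒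
law at `N₀′`), so a producer may work at any fence below `n0DerivedOfRecord` (F0P3-p01 (g35) FENCE NOTE 11:26:13Z: ≥ `m_c(d) − 1`).
HONEST LABEL.  Count-neutral bookkeeping; (β) and the tier-0 T₊ row stay OPEN; `HC_CM` is proved only modulo the 7 printed citations (2 remaining named inputs: hLiu418 =
`stmt-HodgeConjecture-24832`, h413 = `stmt-HodgeConjecture-24833`) until rung 0 closes.

## References
* [Rogawski1990] J. D. Rogawski, *Automorphic Representations of Unitary Groups in Three Variables*, Ann. of Math. Stud. 123 (1990): §4.9 Prop. 4.9.1 (a)(b) p. 55, §4.10 p. 58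
  (the κ-weights of the classes in a stable class).
* [LanglandsShelstad1987] R. P. Langlands, D. Shelstad, *On the definition of transfer factors*, Math. Ann. 278 (1987), §1.3, §3 (κ as a character of `(ℤ∕2)²`).
* [Kottwitz1986BaseChangeUnits] R. E. Kottwitz, *Base change for unit elements of Hecke algebras*, Compositio Math. 60 (1986), §1 pp. 240–241 (fixed-lattice counts).
-/

set_option autoImplicit false

noncomputable section

namespace Summit.HodgeConjecture.HodgeConjecture.Cruxes.H413.F0P3cDyRamCleanSgnKappaForm

open Literature.NumberTheory.Automorphic Literature.NumberTheory.Automorphic.HermitianLattice Literature.NumberTheory.Automorphic.UnitaryGroup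
open Literature.NumberTheory.Automorphic.UnitaryLatticeTree Literature.NumberTheory.Automorphic.UnitaryThreeFourFrame
open Summit.HodgeConjecture.HodgeConjecture.Cruxes.H413.F0P3cDyRamFourFrameLawDefs (DyadicFence)
open Summit.HodgeConjecture.HodgeConjecture.Cruxes.H413.F0P3cDyRamFourFramePieces
open Summit.HodgeConjecture.HodgeConjecture.Cruxes.H413.F0P3cDyRamFourFrameCensusDefs
open Summit.HodgeConjecture.HodgeConjecture.Cruxes.H413.F0P3cDyRamStageOneBDefs
open Summit.HodgeConjecture.HodgeConjecture.Cruxes.H413.F0P3cDyRamStageOneBDerivedDefs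
open scoped Valued WithZero Matrix MatrixGroups

/-! ## §1  `Fin 4` Fourier inversion: constant on the frames ⟺ the three κ-sums vanish -/

/-- The three κ-sums of a frame function, written out (★ #0a H4∕H5: frame `0 ↦ (+,+)`, `1 ↦ (+,−)`, `2 ↦ (−,+)`, `3 ↦ (−,−)`; `κ₀ = ε₁`, `κ₁ = ε₂`, `κ₂ = ε₁ε₂`).
[cite: Rogawski1990, §4.10 p. 58] [cite: LanglandsShelstad1987, §3] -/
theorem sum_kappaChar_mul_eq (n : Fin 4 → ℤ) (i : Fin 3) :
    (∑ b : Fin 4, kappaChar i b * n b) =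
      (![n 0 + n 1 - n 2 - n 3, n 0 - n 1 + n 2 - n 3, n 0 - n 1 - n 2 + n 3] : Fin 3 → ℤ) i := by
  fin_cases i <;> simp [Fin.sum_univ_four, kappaChar, signPair] <;> ring

/-- **`Fin 4` INVERSION**: a function on the four frames is CONSTANT iff its three non-trivial `(ℤ∕2)²`-Fourier coefficients `Σ_b κ_i(b)·n_b` vanish.
[cite: Rogawski1990, §4.10 p. 58] [cite: LanglandsShelstad1987, §3] -/
theorem exists_forall_eq_iff_forall_sum_kappaChar_mul_eq_zero (n : Fin 4 → ℤ) :
    (∃ c : ℤ, ∀ b : Fin 4, n b = c) ↔ ∀ i : Fin 3, (∑ b : Fin 4, kappaChar i b * n b) = 0 := by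
  constructor
  · rintro ⟨c, hc⟩ i
    rw [sum_kappaChar_mul_eq]
    fin_cases i <;> simp [hc]
  · intro h
    have h0 := h 0
    have h1 := h 1
    have h2 := h 2
    rw [sum_kappaChar_mul_eq] at h0 h1 h2
    simp only [Fin.isValue, Matrix.cons_val_zero, Matrix.cons_val_one, Matrix.cons_val] at h0 h1 h2
    refine ⟨n 0, fun b => ?_⟩
    fin_cases b
    · rfl
    · simp only [Fin.mk_one, Fin.isValue]; omega
    · simp only [Fin.reduceFinMk, Fin.isValue]; omega
    · simp only [Fin.reduceFinMk, Fin.isValue]; omega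

/-- The κ-sum of a CONSTANT frame function vanishes (`Σ_b κ_i(b) = 0`). [cite: Rogawski1990, §4.10 p. 58] -/
theorem sum_kappaChar_mul_const (c : ℤ) (i : Fin 3) : (∑ b : Fin 4, kappaChar i b * c) = 0 :=
  (exists_forall_eq_iff_forall_sum_kappaChar_mul_eq_zero fun _ => c).1 ⟨c, fun _ => rfl⟩ i

/-! ## §2  The κ-form of (β) -/

section KappaForm

variable {K : Type} [Field K] [Valued K ℤᵐ⁰] [CompleteSpace K] [Fintype 𝓀[K]]

/-- **THE κ-FORM OF (β).**  `CleanSgnFrameConstLawAt N₀ mc σ ϖ d t` ⟺ under the same binder prefix (datum, four-frame family, element datum above `N₀ d`, frame literals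
`Γ_b`), for each of the three κ-characters the κ-CENSUS OF THE CLEAN SIGN PIECE VANISHES:
`Σ_b κ_i(b)·(transvPlusFixCount σ ϖ d ℓ₀ m* (Γ_b) − cleanMinusFixCount σ ϖ d ℓ₀ m* (mc d) (Γ_b)) = 0` (`ℓ₀ = d % 2`, `m* = mstarOfRecord d`).
[cite: Rogawski1990, §4.9 Prop. 4.9.1 (a)(b) p. 55, §4.10 p. 58] [cite: LanglandsShelstad1987, §1.3, §3] [cite: Kottwitz1986BaseChangeUnits, §1 pp. 240–241] -/
theorem cleanSgnFrameConstLawAt_iff_forall_sum_kappaChar (N₀ mc : ℕ → ℕ) (σ : K →+* K) (ϖ : K) (d t : ℕ) :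
    CleanSgnFrameConstLawAt N₀ mc σ ϖ d t ↔
      (IsRamifiedQuadraticDatum σ ϖ d t →
        ∀ (f : Fin 4 → Fin 3 → (Fin 3 → K)), IsFourFrameFamily σ f →
        ∀ (α β : K) (n₁ n₂ n₃ : ℕ), IsElementDatum σ ϖ (N₀ d) α β n₁ n₂ n₃ →
        ∀ (Γ : Fin 4 → GL (Fin 3) K), (∀ b, (Γ b : Matrix (Fin 3) (Fin 3) K) = frameElt σ f b α β) →
        ∀ i : Fin 3, (∑ b : Fin 4, kappaChar i b *
            ((transvPlusFixCount σ ϖ d (d % 2) (mstarOfRecord d) (Γ b) : ℤ) -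
              (cleanMinusFixCount σ ϖ d (d % 2) (mstarOfRecord d) (mc d) (Γ b) : ℤ))) = 0) := by
  unfold CleanSgnFrameConstLawAt
  refine ⟨fun h hD f hf α β n₁ n₂ n₃ hE Γ hΓ => ?_, fun h hD f hf α β n₁ n₂ n₃ hE Γ hΓ => ?_⟩
  · exact (exists_forall_eq_iff_forall_sum_kappaChar_mul_eq_zero _).1 (h hD f hf α β n₁ n₂ n₃ hE Γ hΓ)
  · exact (exists_forall_eq_iff_forall_sum_kappaChar_mul_eq_zero _).2 (h hD f hf α β n₁ n₂ n₃ hE Γ hΓ)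

/-- **(β) FROM ITS THREE κ-IDENTITIES** (the producer's entrance: each identity is a κ-census with amplitude `0` in the currency of ★ №6 `TransvPlusKappaSignLawAtS2`).
[cite: Rogawski1990, §4.9 Prop. 4.9.1 (a)(b) p. 55, §4.10 p. 58] [cite: LanglandsShelstad1987, §3] -/
theorem cleanSgnFrameConstLawAt_of_forall_sum_kappaChar (N₀ mc : ℕ → ℕ) (σ : K →+* K) (ϖ : K) (d t : ℕ)
    (h : IsRamifiedQuadraticDatum σ ϖ d t →
        ∀ (f : Fin 4 → Fin 3 → (Fin 3 → K)), IsFourFrameFamily σ f →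
        ∀ (α β : K) (n₁ n₂ n₃ : ℕ), IsElementDatum σ ϖ (N₀ d) α β n₁ n₂ n₃ →
        ∀ (Γ : Fin 4 → GL (Fin 3) K), (∀ b, (Γ b : Matrix (Fin 3) (Fin 3) K) = frameElt σ f b α β) →
        ∀ i : Fin 3, (∑ b : Fin 4, kappaChar i b *
            ((transvPlusFixCount σ ϖ d (d % 2) (mstarOfRecord d) (Γ b) : ℤ) -
              (cleanMinusFixCount σ ϖ d (d % 2) (mstarOfRecord d) (mc d) (Γ b) : ℤ))) = 0) :
    CleanSgnFrameConstLawAt N₀ mc σ ϖ d t :=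
  (cleanSgnFrameConstLawAt_iff_forall_sum_kappaChar N₀ mc σ ϖ d t).2 h

/-- **THE κ-CENSUSES OF `T+` AND `T−′` AGREE under (β)**: `Σ_b κ_i(b)·#T+(Γ_b) = Σ_b κ_i(b)·#T−′(Γ_b)` for each `i` (the reading ★ p859751 consumes).
[cite: Rogawski1990, §4.9 Prop. 4.9.1 (a)(b) p. 55, §4.10 p. 58] [cite: LanglandsShelstad1987, §3] -/
theorem sum_kappaChar_mul_transvPlusFixCount_eq_of_cleanSgn {N₀ mc : ℕ → ℕ} {σ : K →+* K} {ϖ : K} {d t : ℕ}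
    (h : CleanSgnFrameConstLawAt N₀ mc σ ϖ d t) (hD : IsRamifiedQuadraticDatum σ ϖ d t)
    {f : Fin 4 → Fin 3 → (Fin 3 → K)} (hf : IsFourFrameFamily σ f) {α β : K} {n₁ n₂ n₃ : ℕ} (hE : IsElementDatum σ ϖ (N₀ d) α β n₁ n₂ n₃)
    {Γ : Fin 4 → GL (Fin 3) K} (hΓ : ∀ b, (Γ b : Matrix (Fin 3) (Fin 3) K) = frameElt σ f b α β) (i : Fin 3) :
    (∑ b : Fin 4, kappaChar i b * (transvPlusFixCount σ ϖ d (d % 2) (mstarOfRecord d) (Γ b) : ℤ)) =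
      ∑ b : Fin 4, kappaChar i b * (cleanMinusFixCount σ ϖ d (d % 2) (mstarOfRecord d) (mc d) (Γ b) : ℤ) := by
  have h0 := (cleanSgnFrameConstLawAt_iff_forall_sum_kappaChar N₀ mc σ ϖ d t).1 h hD f hf α β n₁ n₂ n₃ hE Γ hΓ i
  rw [← sub_eq_zero, ← Finset.sum_sub_distrib, ← h0]
  refine Finset.sum_congr rfl fun b _ => ?_
  ring

end KappaForm

/-! ## §3  (β) is antitone in the threshold schedule -/

section Antitone

variable {K : Type} [Field K] [Valued K ℤᵐ⁰] [CompleteSpace K] [Fintype 𝓀[K]]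

/-- **(β) IS ANTITONE IN `N₀`**: if `N₀ d ≤ N₀′ d` then the law at the (deeper-reaching) fence `N₀` implies the law at `N₀′` — an element datum above `N₀′ d` is one above
`N₀ d`.  (So a producer may discharge (β) at any fence `≤ n0DerivedOfRecord`, e.g. `mcOfRecord − 1`.) [cite: Rogawski1990, §4.9 p. 55] -/
theorem cleanSgnFrameConstLawAt_of_le {N₀ N₀' : ℕ → ℕ} (mc : ℕ → ℕ) (σ : K →+* K) (ϖ : K) {d : ℕ} (t : ℕ) (hle : N₀ d ≤ N₀' d)
    (h : CleanSgnFrameConstLawAt N₀ mc σ ϖ d t) : CleanSgnFrameConstLawAt N₀' mc σ ϖ d t := by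
  intro hD f hf α β n₁ n₂ n₃ hE Γ hΓ
  obtain ⟨h1, h2, h3, h4, h5, h6, h7, h8, hN1, hN2, hN3⟩ := hE
  exact h hD f hf α β n₁ n₂ n₃ ⟨h1, h2, h3, h4, h5, h6, h7, h8, hle.trans hN1, hle.trans hN2, hle.trans hN3⟩ Γ hΓ

/-- The fenced form: `DyadicFence` of (β) at `N₀` gives it at every pointwise-larger `N₀′`. [cite: Rogawski1990, §4.9 p. 55] -/
theorem dyadicFence_cleanSgnFrameConstLawAt_of_le {N₀ N₀' : ℕ → ℕ} (mc : ℕ → ℕ) (σ : K →+* K) (ϖ : K) {d : ℕ} (t : ℕ) (hle : N₀ d ≤ N₀' d)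
    (h : DyadicFence (K := K) (CleanSgnFrameConstLawAt N₀ mc σ ϖ d t)) : DyadicFence (K := K) (CleanSgnFrameConstLawAt N₀' mc σ ϖ d t) :=
  fun h2 => cleanSgnFrameConstLawAt_of_le mc σ ϖ t hle (h h2)

end Antitone

end Summit.HodgeConjecture.HodgeConjecture.Cruxes.H413.F0P3cDyRamCleanSgnKappaForm

end
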